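import Mathlib
import HarnessLib
import Literature.Analysis.FluidPDE.Tao2016AveragedNS.SplitCascadeBlowupHolds
import Literature.Analysis.FluidPDE.Tao2016AveragedNS.SplitCascadePackaging
import Literature.Analysis.FluidPDE.Tao2016AveragedNS.SplitCascadeFrame
import Summits.NavierStokesRegularity.NavierStokesRegularity.Theses.TaoLadderRungOne

/-!
# `TaoLadderRungOne.SplitCascadeBlowup` — the crux R1-b «Theorem 3.3♯» (item stmt-NavierStokesRegularity-19872)

T. Tao, *Finite time blowup for an averaged three-dimensional Navier–Stokes equation*, J. Amer. Math.
Soc. **29** (2016), 601–674 = arXiv:1402.0290v3, Thm. 3.3, §4 (Lemma 4.1, Thm. 4.2, (4.1)), §6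
(Thm. 6.2, Prop. 6.5).
HONEST FRAMING (cell harvest/h2-tao-ladder, TAO-LADDER rung M_1; RUBRIC D4): a statement about Tao's
class of LOCAL CASCADE MODEL EQUATIONS `∂ₜu = Δu + C(u,u)` (Definition 3.1) — the SPLIT cascade
operator `C♯` (Tao's (6.2)-table with every squared mode doubled, square-free) blows up from a
Schwartz divergence-free datum. It is NOT the rung leaf `Target` (which also needs the crux R1-a
`SplitCascadeIsAveragedNoDil`: that `C♯` is a dilation-free averaged Euler operator), and it says
nothing about the true Navier–Stokes equations.

PROOF (all ingredients are tree theorems): at `ε₂ = ½`, for `0 < ε₀ ≤ ½`,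
* `Tao2016AveragedNS.splitLocalCascade_blowup` (`SplitCascadeBlowupHolds.lean`; from the split
  Prop. 6.5 `rescaledSplitStep_holds` ⇒ split Thm. 6.2♯ `noGlobalSplit_holds`
  (`SplitCascadeRescaledStepAssembly.lean`) ⇒ Thm. 4.2♯ ⇒ Lemma 4.1♯ for the two-wavelet datum
  (`SplitCascadeLocalBlowup.lean`)) gives `K, ε > 0` with `splitCoeff ε₀ K ε` square-free such that
  for EVERY seven-profile wavelet data `𝒟` the operator `cascadeOperatorForm ε₀ 𝒟.ψ (splitCoeff ε₀ K ε)`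
  is symmetric with cancellation and its two-wavelet Schwartz divergence-free datum at a large scale
  `n₀` has no global mild `H¹⁰_df` solution;
* `Tao2016.exists_cascadeWaveletData_norm_center` (`SplitCascadeFrame.lean`) gives wavelet data with
  centre moduli `1 + (i+1)ε₀/20` (`i < 7`, inside `(1, 1+ε₀/2)`, pairwise `≥ ε₀/20` apart — the
  moduli of the landed stub `stub_splitWaveletData`, re-derived inline) and ball radii `< ε₀/128`;
* `Tao2016AveragedNS.cascadeOperatorForm_isSplitLocalCascadeForm` (`SplitCascadePackaging.lean`)
  packages that operator as a SPLIT local cascade form: a finite real combination of basic forms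
  (3.1) with annular Fourier supports, ball supports of radius `ε₀/64` about `±ζⱼᵢ`, and input
  moduli gap `|‖ζⱼ₁‖ - ‖ζⱼ₂‖| ≥ ε₀/20`.

## References
* T. Tao, J. Amer. Math. Soc. 29 (2016), 601–674 = arXiv:1402.0290v3, Thm. 3.3, §4, §6.
  [`Tao2016AveragedNS`]
-/

noncomputable section

-- the sub-problem namespace `Summit.NavierStokesRegularity.NavierStokesRegularity` repeats the summit name by design (D-0017)
set_option linter.dupNamespace false

namespace Summit.NavierStokesRegularity.NavierStokesRegularity.Theorems

open Literature.Analysis.FluidPDE Literature.Analysis.FluidPDE.Tao2016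
  Literature.Analysis.FluidPDE.Tao2016AveragedNS

/-- **Item stmt-NavierStokesRegularity-19872 (`TaoLadderRungOne.SplitCascadeBlowup`, R1-b
«Theorem 3.3♯») — PROVED.** There is `ε₂ > 0` (`= ½`) such that for every `0 < ε₀ ≤ ε₂` some split
local cascade form `T` of scale parameter `ε₀` (a finite real combination of basic cascade forms
whose profiles have annular Fourier support refined to balls of radius `ε₀/64` about `±ζⱼᵢ` with
input moduli gap `≥ ε₀/20`) is symmetric in its first two slots, has the cancellation `T(u,u,u) = 0`
on `H¹⁰_df`, and admits a Schwartz divergence-free datum from which `∂ₜu = Δu + T(u,u)` has no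
global mild `H¹⁰_df` solution. Witness: the split cascade operator `C♯` on modulus-separated wavelet
data and the two-wavelet datum `(ψ_{0,n₀} + ψ_{1,n₀})/√2`. MODEL statement; nothing about
Navier–Stokes. [cite: Tao2016AveragedNS, Thm. 3.3; §4; §6] -/
theorem splitCascadeBlowup_proof :
    Summit.NavierStokesRegularity.NavierStokesRegularity.Theses.TaoLadderRungOne.SplitCascadeBlowup := by
  unfold Summit.NavierStokesRegularity.NavierStokesRegularity.Theses.TaoLadderRungOne.SplitCascadeBlowup
  refine ⟨1 / 2, by norm_num, fun ε₀ hε₀ hε₀le => ?_⟩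
  have hε₀1 : ε₀ < 1 := hε₀le.trans_lt (by norm_num)
  -- the split moduli `ρᵢ = 1 + (i+1)ε₀/20`, `i < 7`: inside `(1, 1+ε₀/2)`, pairwise `≥ ε₀/20` apart
  have hmem : ∀ i : Fin 7,
      1 < 1 + ((i : ℕ) + 1 : ℝ) * ε₀ / 20 ∧ 1 + ((i : ℕ) + 1 : ℝ) * ε₀ / 20 < 1 + ε₀ / 2 := by
    intro i
    have hi : ((i : ℕ) : ℝ) + 1 ≤ 7 := by
      have : (i : ℕ) + 1 ≤ 7 := i.isLt
      exact_mod_cast this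
    have hi0 : (0 : ℝ) ≤ (i : ℕ) := by positivity
    constructor
    · have : 0 < ((i : ℕ) + 1 : ℝ) * ε₀ / 20 := by positivity
      linarith
    · nlinarith
  have hgap0 : ∀ i j : Fin 7, i ≠ j →
      ε₀ / 20 ≤ |(1 + ((i : ℕ) + 1 : ℝ) * ε₀ / 20) - (1 + ((j : ℕ) + 1 : ℝ) * ε₀ / 20)| := by
    intro i j hij
    have hne : ((i : ℕ) : ℝ) ≠ (j : ℕ) := by
      intro h; exact hij (Fin.ext (by exact_mod_cast h))
    have hdiff : (1 + ((i : ℕ) + 1 : ℝ) * ε₀ / 20) - (1 + ((j : ℕ) + 1 : ℝ) * ε₀ / 20) =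
        (((i : ℕ) : ℝ) - (j : ℕ)) * (ε₀ / 20) := by ring
    rw [hdiff, abs_mul, abs_of_pos (by positivity : (0 : ℝ) < ε₀ / 20)]
    have h1 : (1 : ℝ) ≤ |((i : ℕ) : ℝ) - (j : ℕ)| := by
      rcases lt_or_gt_of_ne hne with h | h
      · have : ((i : ℕ) : ℝ) + 1 ≤ (j : ℕ) := by
          exact_mod_cast (show (i : ℕ) < j by exact_mod_cast h)
        rw [abs_of_neg (by linarith)]; linarith
      · have : ((j : ℕ) : ℝ) + 1 ≤ (i : ℕ) := by
          exact_mod_cast (show (j : ℕ) < i by exact_mod_cast h)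
        rw [abs_of_pos (by linarith)]; linarith
    nlinarith
  -- Theorem 3.3♯ for every seven-profile wavelet data
  obtain ⟨K, ε, -, -, hsq, hall⟩ := splitLocalCascade_blowup hε₀ hε₀1
  -- wavelet data with prescribed, separated centre moduli and tiny balls
  obtain ⟨𝒟, hc, hr⟩ := exists_cascadeWaveletData_norm_center (ε₀ := ε₀)
    (fun i : Fin 7 => 1 + ((i : ℕ) + 1 : ℝ) * ε₀ / 20) hmem (by positivity : (0 : ℝ) < ε₀ / 128)
  obtain ⟨-, hsymm, hcanc, N₀, hN₀⟩ := hall 𝒟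
  obtain ⟨hdiv, hno⟩ := hN₀ N₀ le_rfl
  have hnorm : ∀ i, 1 < ‖𝒟.center i‖ ∧ ‖𝒟.center i‖ ≤ 1 + ε₀ / 2 := fun i => by
    rw [hc i]
    exact ⟨(hmem i).1, (hmem i).2.le⟩
  have hgap : ∀ i j, i ≠ j → ε₀ / 20 ≤ |‖𝒟.center i‖ - ‖𝒟.center j‖| := fun i j hij => by
    rw [hc i, hc j]
    exact hgap0 i j hij
  -- the packaging as a split local cascade form
  obtain ⟨k, c, ψ, ζ, hann, hball, hg, hrepr⟩ :=
    cascadeOperatorForm_isSplitLocalCascadeForm hε₀ hε₀1.le 𝒟 (fun i => (hr i).le) hnorm hgap hsq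
  exact ⟨cascadeOperatorForm ε₀ 𝒟.ψ (splitCoeff ε₀ K ε), ⟨k, c, ψ, ζ, hann, hball, hg, hrepr⟩,
    fun u v w _ _ _ => hsymm u v w, fun u _ => hcanc u, splitSchwartzDatum hε₀ 𝒟 N₀, hdiv, hno⟩

end Summit.NavierStokesRegularity.NavierStokesRegularity.Theorems

end
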